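import Literature.AlgebraicGeometry.HodgeTheory.DivisorLefschetzGroupCentreTorus
import Literature.AlgebraicGeometry.HodgeTheory.DivisorLefschetzGroupCommutant
import Literature.AlgebraicGeometry.HodgeTheory.WeilClassesFieldCommutativeDivisorAlgebra
import HarnessLib

/-!
# Moonen–Zarhin's Lemma (1), second sentence, the other half: «… in all other cases it [the centre `Z(G_div(X)) =
# U_{K_B}`] is finite» — ON `ℂ`-POINTS, FROM `End(X)`-LEVEL DATA: every central element of `G_div(X)(ℂ)` is an
# involution and the centre is a finite elementary abelian `2`-group of order `≤ 2^{[K:ℚ]}`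
# (Moonen–Zarhin 1998 §1, on the carrier `H¹(X(ℂ); ℂ)`)

Layer `Literature/AlgebraicGeometry/HodgeTheory`; THEOREMS ONLY — no definition, no named fact, no `sorry` (D-0026, net
debt 0).  Companion of the seat's `DivisorLefschetzGroupCentreTorus` (generation 26: for type 4 with `d ≥ 2` or `m ≥ 2`
the centre is `(ℂ^×)^{e₀}`, infinite).  Inputs BY NAME: the seat's `DivisorLefschetzGroupCommutant` (g15/g17: Lemma (1)
«`Z(G_div(X)(ℂ)) = U_{K_B}(ℂ)`» UNCONDITIONALLY, `mem_divisorLefschetzGroup_and_forall_comm_iff_of_isKaehlerClass'`),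
`WeilClassesFieldCommutativeDivisorAlgebra` (g16: «`B = S_λ`» for commutative `B`,
`mem_symmetricPullbackSpan_of_mem_adjoin_of_comm`), `DivisorLefschetzGroupEigenspaceSplitting` (g14: the sign elements
`p(ζ^*)`, `p(τ) = ±1`, `mul_self_eq_one_of_mem_divisorLefschetzGroup_coe_eq_aeval`, `eq_of_coe_eq_aeval_of_forall_eval_eq`),
`DivisorLefschetzGroupIsogeny` Chapter II (g15: Lemma (1) under «`B = End⁰(X)`», `mem_center_divisorLefschetzGroup_iff_coe_mem_span`)
and `Milne1999/BicommutantFaithful` (`center_le_adjoin_of_forall_central`, `mem_adjoin_pullbackOne_of_center_le`).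

## The print

B. J. J. Moonen, Yu. G. Zarhin, *Weil classes on abelian varieties*, J. reine angew. Math. **496** (1998) 83–92 =
arXiv:alg-geom/9612017 [MoonenZarhin1998WeilClasses], §1 (held text `paper:arxiv-alg-geom_9612017`), chunk p0002
L121–L127, Lemma, VERBATIM: «(1) The center of `G_div(X)` is the group `U_{K_B}` given by `U_{K_B}(R) = {a ∈ (K_B ⊗_ℚ R)^*
∣ a a† = 1}`. For `X` of type 4 with either `d ≥ 2` or `m ≥ 2` this is a connected torus of rank `e₀`; in all other cases
it is finite.»; chunk p0003 L8–L10: «Proof. To prove this, we can first extend scalars to `ℂ`, and (1) and (2) then readily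
follow from Table 2.»  Table 1 (chunk p0002 L63–L64 «For all possible types in the Albert classification one can determine
the algebra `B` and its center `K_B`»; L96–L97 «if `m ≥ 2` or if `X` is of type 1 or 2, then we simply have `Δ = D`. If
`m = 1` then `Δ = B`»; chunk p0003 L82–L90 «`G_div(X)` acts as the identity on `W_F` if and only if `F ⊆ B`» for types
1, 2, type 3 with `m = 1`, type 4 with `d = 1`, `m = 1`; L109 «We have `B = Mat_m(D)`» for type 3, `m ≥ 2`): in «all
other cases» the centre `K_B` of `B` is TOTALLY REAL (`K_B = E` for types 1, 2 and type 3, `K_B = E₀` for type 4 with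
`d = m = 1`), so `†` is trivial on `K_B` and `U_{K_B}(ℂ) = {a ∈ K_B ⊗ ℂ ∣ a² = 1} = μ₂^{[K_B:ℚ]}`.

## What is proved (the mechanism «`†` trivial on `K_B` ⟹ `a a† = a² = 1`», and the finite count)

* §1 ON THE CARRIER (every complex abelian variety `A`, any class `h`):
  `mul_self_eq_one_of_mem_divisorLefschetzGroup_of_coe_mem_symmetricPullbackSpan` (an element of `G_div(X)(h)(ℂ)` whose
  underlying endomorphism is Rosati-SYMMETRIC is an involution, `Q_h` non-degenerate: `Q_h(x, u²y) = Q_h(ux, uy) =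
  Q_h(x, y)`); **`mul_self_eq_one_of_mem_center_divisorLefschetzGroup_of_isKaehlerClass`** (if the CENTRE of `B ⊗ ℂ` consists
  of Rosati-symmetric elements — «`†` trivial on `K_B`» — every central element of `G_div(X)(h)(ℂ)` is an involution; `h`
  rational with a Kähler multiple, the hypotheses of the seat's unconditional Lemma (1));
  `finite_center_divisorLefschetzGroup_of_forall` (if every central element is an involution lying in `ℂ[ψ^*]` for some
  `ψ ∈ End(A)` with `R(ψ) = 0`, `R` irreducible over `ℚ`, the centre is FINITE of order `≤ 2^{deg R}`: a central element is
  `p(ψ^*)` with `p(τ) = ±1` at the eigenvalues, determined by its sign vector).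
* §2 FROM `End(X)`-LEVEL DATA — the print's «all other cases» as hypotheses on `End(X)`:
  **`finite_center_divisorLefschetzGroup_of_symmetricPullbackSpan_le_adjoin_singleton`** («`B ⊆ E = ℚ(ψ)`»: every
  Rosati-symmetric element of `End⁰(X) ⊗ ℂ` lies in `ℂ[ψ^*]` — type 3 with `m = 1` (`B = E`), type 4 with `d = m = 1`
  (`B = E₀`), type 1 with `m = 1` and `D = E`: all central elements are involutions, the centre is finite of order
  `≤ 2^{deg R}`); **`finite_center_divisorLefschetzGroup_of_forall_exists_zsmul_mem_closure`** (the special case `End⁰(X) = ℚ(ψ)`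
  a field: every `g ∈ End(X)` has `N g ∈ ℤ[ψ]`); **`finite_center_divisorLefschetzGroup_of_forall_mem_adjoin_of_symm`**
  («`B = End⁰(X)` with totally real centre `E = ℚ(ψ)`», `ψ` central and Rosati-SYMMETRIC, `Z(End⁰ X) = ℚ(ψ)`, every `χ^* ∈
  B ⊗ ℂ` — types 1 and 2 for all `m`, type 3 with `m ≥ 2`: the same conclusions, with `h ∈ B¹ ⊗ ℂ`, `Q_h` non-degenerate).

## Scope (honest column)

`ℂ`-points only; the identification of `K_B` per Albert type (Table 1) is replaced by the stated `End(X)`-level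
hypotheses, each of which the tree verifies in the corresponding files (`WeilClassesFieldCommutativeDivisorAlgebra`,
`DivisorAlgebraPowers`, `WeilClassesFieldTypeOneTwoEndLevel`, `WeilClassesFieldDefiniteQuaternion*`); the exact order
`2^{[K_B:ℚ]}` is not computed (only the bound `2^{deg R}` and the exponent `2`).

## References

* [MoonenZarhin1998WeilClasses] B. J. J. Moonen, Yu. G. Zarhin, Weil classes on abelian varieties, J. reine angew. Math.
  496 (1998) 83–92; arXiv:alg-geom/9612017: §1 Lemma (1) (chunk p0002 L121–L127), Table 1, proof (chunk p0003 L8–L10).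
* [Milne1999LefschetzClasses] J. S. Milne, Lefschetz classes on abelian varieties, Duke Math. J. 96 (1999) 639–675, §1
  Remark 1.2, §2 pp. 645–651.
* [LangeBirkenhake1992] H. Lange, Ch. Birkenhake, Complex Abelian Varieties, §5.1, §5.5.
* [Deligne1982HodgeCycles] P. Deligne, Hodge cycles on abelian varieties, LNM 900 (1982), I §3 Prop. 3.4.

## Provenance

Lane `lit-hodgefound` (Track 2, Layer A), prover seat `lit-hodgefound-p21` (generation 26), row g26-#6.
-/

noncomputable section

open CategoryTheory Polynomial Module
open Literature.AlgebraicTopology.SingularHomology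
open Literature.AlgebraicGeometry.Motives
open Literature.AlgebraicGeometry.VanGeemen1994 (hodgeClassSpan pullbackOne)
open Literature.AlgebraicGeometry.Milne1999

namespace Literature.AlgebraicGeometry.HodgeTheory

/-! ### §1 ON THE CARRIER: symmetric elements of `G_div` are involutions; involutions in `ℂ[ψ^*]` are finitely many -/

section Carrier

variable {A : AbelianVariety ℂ} {h : complexBetti A.X 2} {ψ : A ⟶ A} {R : Polynomial ℤ}

/-- **A Rosati-SYMMETRIC element of `G_div(X)(h)(ℂ)` is an involution** (`Q_h` non-degenerate): `Q_h(x, u(u y)) =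
Q_h(u x, u y) = Q_h(x, y)` for all `x`, so `u² = 1` — Lemma (1)'s «`a a† = 1`» with `a† = a`.
[cite: MoonenZarhin1998WeilClasses, §1 Lemma (1) (chunk p0002 L121–L127: «U_{K_B}(R) = {a ∈ (K_B ⊗ R)^* ∣ a a† = 1} … in all other cases it is finite»)]
[cite: LangeBirkenhake1992, §5.1] -/
theorem mul_self_eq_one_of_mem_divisorLefschetzGroup_of_coe_mem_symmetricPullbackSpan
    (hnd : ∀ x : complexBetti A.X 1, (∀ y, polarizationPairingOne A.X h (A.dim - 1) x y = 0) → x = 0)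
    {u : complexBetti A.X 1 ≃ₗ[ℂ] complexBetti A.X 1} (hu : u ∈ divisorLefschetzGroup A h)
    (hus : (u : Module.End ℂ (complexBetti A.X 1)) ∈ symmetricPullbackSpan A h) : u * u = 1 := by
  obtain ⟨B, hBalt, hBnd, lam, -, hBQ⟩ := exists_bilinForm_isAlt_nondegenerate (A := A) hnd
  have hs : ∀ x w : complexBetti A.X 1, polarizationPairingOne A.X h (A.dim - 1) (u x) w =
      polarizationPairingOne A.X h (A.dim - 1) x (u w) := fun x w ↦ by
    simpa only [LinearEquiv.coe_coe] using hus.2 x w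
  refine LinearEquiv.ext fun y ↦ ?_
  rw [LinearEquiv.mul_apply]
  change u (u y) = y
  rw [← sub_eq_zero]
  refine hBnd.1 _ fun x ↦ ?_
  rw [← hBalt.neg_eq, neg_eq_zero, map_sub, hBQ, hBQ, ← hs, hu.2, sub_self]

/-- **«`†` TRIVIAL ON `K_B` ⟹ EVERY CENTRAL ELEMENT OF `G_div(X)(ℂ)` IS AN INVOLUTION».**  For `0 < dim A` and a rational
class `h` with a Kähler multiple `s · h` (a polarization class): if every element of the centre of `B ⊗ ℂ = ℂ⟨S_λ ⊗ ℂ⟩`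
is Rosati-symmetric (i.e. lies in `S_λ ⊗ ℂ` — «`K_B` totally real»), then every `z ∈ Z(G_div(X)(h)(ℂ))` satisfies
`z² = 1` (by the seat's unconditional Lemma (1), `z ∈ Z(B ⊗ ℂ)`, and by the previous theorem).  This is the mechanism of
«in all other cases it is finite»: `U_{K_B}(ℂ) = {a ∣ a² = 1}`.
[cite: MoonenZarhin1998WeilClasses, §1 Lemma (1) (chunk p0002 L121–L127)] [cite: Deligne1982HodgeCycles, I §3 Prop. 3.4] -/
theorem mul_self_eq_one_of_mem_center_divisorLefschetzGroup_of_isKaehlerClass (hA : 0 < A.dim) (hQ : IsRationalClass h)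
    {s : ℝ} (hs : s ≠ 0) (hK : IsKaehlerClass A.dim A.X ((s : ℂ) • h))
    (hKB : ∀ T ∈ Algebra.adjoin ℂ (symmetricPullbackSpan A h : Set (Module.End ℂ (complexBetti A.X 1))),
      (∀ T' ∈ Algebra.adjoin ℂ (symmetricPullbackSpan A h : Set (Module.End ℂ (complexBetti A.X 1))), T * T' = T' * T) →
        T ∈ symmetricPullbackSpan A h)
    {z : divisorLefschetzGroup A h} (hz : z ∈ Subgroup.center (divisorLefschetzGroup A h)) : z * z = 1 := by
  have hnd := eq_zero_of_forall_polarizationPairingOne_eq_zero_of_isKaehlerClass_smul' hs hK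
  have hc : ∀ g ∈ divisorLefschetzGroup A h, g * (z : complexBetti A.X 1 ≃ₗ[ℂ] complexBetti A.X 1) = z * g :=
    fun g hg ↦ congrArg Subtype.val (Subgroup.mem_center_iff.1 hz ⟨g, hg⟩)
  obtain ⟨hzB, hzc, -⟩ := (mem_divisorLefschetzGroup_and_forall_comm_iff_of_isKaehlerClass' hA hQ hs hK).1 ⟨z.2, hc⟩
  exact Subtype.ext
    (mul_self_eq_one_of_mem_divisorLefschetzGroup_of_coe_mem_symmetricPullbackSpan hnd z.2 (hKB _ hzB hzc))

/-- **THE FINITE COUNT.**  Let `ψ ∈ End(A)` with `R(ψ) = 0`, `R ∈ ℤ[T]` irreducible over `ℚ`.  If every central element of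
`G_div(X)(h)(ℂ)` is an INVOLUTION whose underlying endomorphism lies in `ℂ[ψ^*]`, then the centre is FINITE, of order at
most `2^{deg R}`: a central `z = p(ψ^*)` has `p(τ)² = 1`, `p(τ) = ±1`, at every eigenvalue `τ` of `ψ^*` (a root of `R`),
and is determined by the sign vector `τ ↦ p(τ)` (the tree's `eq_of_coe_eq_aeval_of_forall_eval_eq`): `U_{K}(ℂ) ↪ μ₂^{Σ}`.
[cite: MoonenZarhin1998WeilClasses, §1 Lemma (1) (chunk p0002 L121–L127: «in all other cases it is finite»)] -/
theorem finite_center_divisorLefschetzGroup_of_forall (hRirr : Irreducible (R.map (Int.castRingHom ℚ)))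
    (hψR : Polynomial.eval₂ (Int.castRingHom (CategoryTheory.End A)) (ψ : CategoryTheory.End A) R = 0)
    (hmem : ∀ z : divisorLefschetzGroup A h, z ∈ Subgroup.center (divisorLefschetzGroup A h) →
      ((z : complexBetti A.X 1 ≃ₗ[ℂ] complexBetti A.X 1) : Module.End ℂ (complexBetti A.X 1)) ∈
        Algebra.adjoin ℂ ({pullbackOne A ψ} : Set (Module.End ℂ (complexBetti A.X 1))))
    (hinv : ∀ z : divisorLefschetzGroup A h, z ∈ Subgroup.center (divisorLefschetzGroup A h) → z * z = 1) :
    Finite (Subgroup.center (divisorLefschetzGroup A h)) ∧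
      Nat.card (Subgroup.center (divisorLefschetzGroup A h)) ≤ 2 ^ R.natDegree := by
  classical
  set T : Module.End ℂ (complexBetti A.X 1) := pullbackOne A ψ with hTdef
  set G := divisorLefschetzGroup A h with hGdef
  -- polynomial representatives
  have hex : ∀ z : Subgroup.center G, ∃ p : ℂ[X],
      ((z.1 : complexBetti A.X 1 ≃ₗ[ℂ] complexBetti A.X 1) : Module.End ℂ (complexBetti A.X 1)) = aeval T p := by
    intro z
    have hz := hmem z.1 z.2
    rw [Algebra.adjoin_singleton_eq_range_aeval] at hz
    obtain ⟨p, hp⟩ := (AlgHom.mem_range _).1 hz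
    exact ⟨p, hp.symm⟩
  choose p hp using hex
  -- the signs `p(τ) = ±1`
  have hsign : ∀ (z : Subgroup.center G) (τ : ℂ), Module.End.HasEigenvalue T τ →
      (p z).eval τ = 1 ∨ (p z).eval τ = -1 := by
    intro z τ hτ
    obtain ⟨x, hx⟩ := hτ.exists_hasEigenvector
    have hzx : (z.1 : complexBetti A.X 1 ≃ₗ[ℂ] complexBetti A.X 1) x = (p z).eval τ • x := by
      have e := LinearMap.congr_fun (hp z) x
      rw [LinearEquiv.coe_coe] at e
      rw [e, Module.End.aeval_apply_of_hasEigenvector hx]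
    have e1 := congrArg (fun g : G ↦ (g : complexBetti A.X 1 ≃ₗ[ℂ] complexBetti A.X 1) x) (hinv z.1 z.2)
    change (z.1 : complexBetti A.X 1 ≃ₗ[ℂ] complexBetti A.X 1) ((z.1 : complexBetti A.X 1 ≃ₗ[ℂ] complexBetti A.X 1) x) = x
      at e1
    rw [hzx, map_smul, hzx, smul_smul] at e1
    have e2 : (p z).eval τ * (p z).eval τ = 1 :=
      smul_left_injective ℂ hx.2 (e1.trans (one_smul ℂ x).symm)
    exact mul_self_eq_one_iff.1 e2
  -- the sign vector on the root set determines `z`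
  set s : Finset ℂ := (R.map (Int.castRingHom ℂ)).roots.toFinset with hsdef
  have hR0 : R ≠ 0 := fun h0 ↦ hRirr.ne_zero (by rw [h0, Polynomial.map_zero])
  let F : Subgroup.center G → (↥s → Bool) := fun z τ ↦ decide ((p z).eval (τ : ℂ) = 1)
  have hF : Function.Injective F := by
    intro z w hzw
    have hall : ∀ τ : ℂ, Module.End.HasEigenvalue T τ → (p z).eval τ = (p w).eval τ := by
      intro τ hτ
      have hτs : τ ∈ s := (mem_roots_toFinset_map_iff hR0 τ).2 (eval₂_eq_zero_of_hasEigenvalue_pullbackOne hψR hτ)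
      have e := congrFun hzw ⟨τ, hτs⟩
      simp only [F, decide_eq_decide] at e
      rcases hsign z τ hτ with hz1 | hz1 <;> rcases hsign w τ hτ with hw1 | hw1
      · rw [hz1, hw1]
      · exact absurd (e.1 hz1) (by rw [hw1]; norm_num)
      · exact absurd (e.2 hw1) (by rw [hz1]; norm_num)
      · rw [hz1, hw1]
    have heq : (z.1 : complexBetti A.X 1 ≃ₗ[ℂ] complexBetti A.X 1) = w.1 :=
      eq_of_coe_eq_aeval_of_forall_eval_eq hRirr hψR (hp z) (hp w) hall
    exact Subtype.ext (Subtype.ext heq)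
  refine ⟨Finite.of_injective F hF, (Nat.card_le_card_of_injective F hF).trans ?_⟩
  -- `#(s → Bool) = 2^{#s} ≤ 2^{deg R}`
  rw [Nat.card_eq_fintype_card, Fintype.card_fun, Fintype.card_bool, Fintype.card_coe]
  refine Nat.pow_le_pow_right two_pos ?_
  calc s.card ≤ Multiset.card (R.map (Int.castRingHom ℂ)).roots := Multiset.toFinset_card_le _
    _ ≤ (R.map (Int.castRingHom ℂ)).natDegree := Polynomial.card_roots' _
    _ = R.natDegree := Polynomial.natDegree_map_eq_of_injective (Int.castRingHom ℂ).injective_int _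

end Carrier

/-! ### §2 FROM `End(X)`-LEVEL DATA: the print's «all other cases» -/

section EndLevel

variable {A : AbelianVariety ℂ} {h : complexBetti A.X 2} {ψ : A ⟶ A} {R : Polynomial ℤ}

/-- **«IN ALL OTHER CASES IT IS FINITE», THE ROWS WITH `B ⊆ E = ℚ(ψ)`** (type 3 with `m = 1`: `B = E`; type 4 with
`d = m = 1`: `B = E₀`; type 1 with `m = 1`, `D = E`): let `0 < dim A`, `h` rational with a Kähler multiple, `ψ ∈ End(A)` with
`R(ψ) = 0` (`R` irreducible over `ℚ`), and suppose every Rosati-symmetric element of `End⁰(A) ⊗ ℂ` lies in `ℂ[ψ^*]`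
(`S_λ ⊗ ℂ ⊆ E ⊗ ℂ`).  Then `B ⊗ ℂ = S_λ ⊗ ℂ` is commutative, every central element of `G_div(X)(h)(ℂ)` is an involution,
and the centre is finite of order `≤ 2^{deg R}`.
[cite: MoonenZarhin1998WeilClasses, §1 Lemma (1) (chunk p0002 L121–L127) with Table 1 (chunk p0002 L63–L64, L96–L97; chunk p0003 L82–L90)]
[cite: Deligne1982HodgeCycles, I §3 Prop. 3.4] -/
theorem finite_center_divisorLefschetzGroup_of_symmetricPullbackSpan_le_adjoin_singleton (hA : 0 < A.dim)
    (hQ : IsRationalClass h) {s : ℝ} (hs : s ≠ 0) (hK : IsKaehlerClass A.dim A.X ((s : ℂ) • h))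
    (hRirr : Irreducible (R.map (Int.castRingHom ℚ)))
    (hψR : Polynomial.eval₂ (Int.castRingHom (CategoryTheory.End A)) (ψ : CategoryTheory.End A) R = 0)
    (hSψ : ∀ T ∈ symmetricPullbackSpan A h,
      T ∈ Algebra.adjoin ℂ ({pullbackOne A ψ} : Set (Module.End ℂ (complexBetti A.X 1)))) :
    (∀ z ∈ Subgroup.center (divisorLefschetzGroup A h), z * z = 1) ∧
      Finite (Subgroup.center (divisorLefschetzGroup A h)) ∧
      Nat.card (Subgroup.center (divisorLefschetzGroup A h)) ≤ 2 ^ R.natDegree := by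
  have hle : Algebra.adjoin ℂ (symmetricPullbackSpan A h : Set (Module.End ℂ (complexBetti A.X 1))) ≤
      Algebra.adjoin ℂ ({pullbackOne A ψ} : Set (Module.End ℂ (complexBetti A.X 1))) :=
    Algebra.adjoin_le fun T hT ↦ hSψ T hT
  -- `S_λ ⊗ ℂ ⊆ ℂ[ψ^*]` is commutative, so `B ⊗ ℂ = S_λ ⊗ ℂ`
  have hcomm : ∀ S₁ ∈ symmetricPullbackSpan A h, ∀ S₂ ∈ symmetricPullbackSpan A h, S₁ * S₂ = S₂ * S₁ :=
    fun S₁ h₁ S₂ h₂ ↦ (Algebra.commute_of_mem_adjoin_singleton_of_commute (hSψ S₂ h₂)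
      (Algebra.commute_of_mem_adjoin_self (hSψ S₁ h₁)).symm).eq
  have hKB : ∀ T ∈ Algebra.adjoin ℂ (symmetricPullbackSpan A h : Set (Module.End ℂ (complexBetti A.X 1))),
      (∀ T' ∈ Algebra.adjoin ℂ (symmetricPullbackSpan A h : Set (Module.End ℂ (complexBetti A.X 1))), T * T' = T' * T) →
        T ∈ symmetricPullbackSpan A h :=
    fun T hT _ ↦ mem_symmetricPullbackSpan_of_mem_adjoin_of_comm hcomm hT
  have hinv : ∀ z : divisorLefschetzGroup A h, z ∈ Subgroup.center (divisorLefschetzGroup A h) → z * z = 1 :=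
    fun z hz ↦ mul_self_eq_one_of_mem_center_divisorLefschetzGroup_of_isKaehlerClass hA hQ hs hK hKB hz
  have hmem : ∀ z : divisorLefschetzGroup A h, z ∈ Subgroup.center (divisorLefschetzGroup A h) →
      ((z : complexBetti A.X 1 ≃ₗ[ℂ] complexBetti A.X 1) : Module.End ℂ (complexBetti A.X 1)) ∈
        Algebra.adjoin ℂ ({pullbackOne A ψ} : Set (Module.End ℂ (complexBetti A.X 1))) := by
    intro z hz
    have hc : ∀ g ∈ divisorLefschetzGroup A h, g * (z : complexBetti A.X 1 ≃ₗ[ℂ] complexBetti A.X 1) = z * g :=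
      fun g hg ↦ congrArg Subtype.val (Subgroup.mem_center_iff.1 hz ⟨g, hg⟩)
    obtain ⟨hzB, -, -⟩ := (mem_divisorLefschetzGroup_and_forall_comm_iff_of_isKaehlerClass' hA hQ hs hK).1 ⟨z.2, hc⟩
    exact hle hzB
  exact ⟨hinv, finite_center_divisorLefschetzGroup_of_forall hRirr hψR hmem hinv⟩

/-- **… in particular when `End⁰(X) = E = ℚ(ψ)` IS A FIELD** (every `g ∈ End(X)` has `N g ∈ ℤ[ψ]` for some `N ≠ 0` — type 4
with `d = m = 1`, a simple CM abelian variety; type 1 with `m = 1` and `D = E`): every central element of `G_div(X)(h)(ℂ)` is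
an involution and the centre is finite of order `≤ 2^{[E:ℚ]}` («in all other cases it is finite»).
[cite: MoonenZarhin1998WeilClasses, §1 Lemma (1) (chunk p0002 L121–L127) and Criterion (2) case «Type 4, d = 1, m = 1» (chunk p0003 L74, L82–L90)]
[cite: Deligne1982HodgeCycles, I §3 Prop. 3.4] -/
theorem finite_center_divisorLefschetzGroup_of_forall_exists_zsmul_mem_closure (hA : 0 < A.dim)
    (hQ : IsRationalClass h) {s : ℝ} (hs : s ≠ 0) (hK : IsKaehlerClass A.dim A.X ((s : ℂ) • h))
    (hRirr : Irreducible (R.map (Int.castRingHom ℚ)))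
    (hψR : Polynomial.eval₂ (Int.castRingHom (CategoryTheory.End A)) (ψ : CategoryTheory.End A) R = 0)
    (hgen : ∀ g : A ⟶ A, ∃ N : ℤ, N ≠ 0 ∧ End.of (N • g) ∈ Subring.closure {End.of ψ}) :
    (∀ z ∈ Subgroup.center (divisorLefschetzGroup A h), z * z = 1) ∧
      Finite (Subgroup.center (divisorLefschetzGroup A h)) ∧
      Nat.card (Subgroup.center (divisorLefschetzGroup A h)) ≤ 2 ^ R.natDegree := by
  refine finite_center_divisorLefschetzGroup_of_symmetricPullbackSpan_le_adjoin_singleton hA hQ hs hK hRirr hψR fun T hT ↦ ?_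
  have hle : Submodule.span ℂ (Set.range fun χ : A ⟶ A ↦ pullbackOne A χ) ≤
      Subalgebra.toSubmodule (Algebra.adjoin ℂ ({pullbackOne A ψ} : Set (Module.End ℂ (complexBetti A.X 1)))) :=
    Submodule.span_le.2 (by
      rintro _ ⟨χ, rfl⟩
      exact pullbackOne_mem_adjoin_singleton_of_exists_zsmul_mem_closure_singleton (hgen χ))
  exact hle hT.1

/-- **«IN ALL OTHER CASES IT IS FINITE», THE ROWS WITH `B = End⁰(X)` AND TOTALLY REAL CENTRE `K_B = E = ℚ(ψ)`** (types 1
and 2 for every `m`, type 3 with `m ≥ 2`): let `h ∈ B¹ ⊗ ℂ` with `Q_h` non-degenerate, `ψ ∈ End(A)` central and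
Rosati-SYMMETRIC with `R(ψ) = 0` (`R` irreducible over `ℚ`), every `g ∈ Z(End(A))` with `N g ∈ ℤ[ψ]` («`Z(End⁰ X) = E`
totally real»), and `B ⊗ ℂ = End⁰(X) ⊗ ℂ` (every `χ^*` in `ℂ⟨S_λ ⊗ ℂ⟩`).  Then a central `z` of `G_div(X)(h)(ℂ)` lies in
`Z(E'') = ℂ[ψ^*]`, is an involution (`z = p(ψ^*)`, `p(τ) = ±1`), and the centre is finite of order `≤ 2^{deg R}`:
`U_E(ℂ) = μ₂^{Σ_E}`.
[cite: MoonenZarhin1998WeilClasses, §1 Lemma (1) (chunk p0002 L121–L127) with Table 1 (chunk p0002 L96–L97 «Δ = D»; chunk p0003 L109 «B = Mat_m(D)»)]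
[cite: Milne1999LefschetzClasses, §1 Remark 1.2 (p. 643), §2 pp. 645–650] -/
theorem finite_center_divisorLefschetzGroup_of_forall_mem_adjoin_of_symm (hh : h ∈ hodgeClassSpan A.dim A.X 1)
    (hnd : ∀ x : complexBetti A.X 1, (∀ y, polarizationPairingOne A.X h (A.dim - 1) x y = 0) → x = 0)
    (hRirr : Irreducible (R.map (Int.castRingHom ℚ)))
    (hψR : Polynomial.eval₂ (Int.castRingHom (CategoryTheory.End A)) (ψ : CategoryTheory.End A) R = 0)
    (hsym : ∀ x y : complexBetti A.X 1, polarizationPairingOne A.X h (A.dim - 1) (pullbackOne A ψ x) y =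
      polarizationPairingOne A.X h (A.dim - 1) x (pullbackOne A ψ y))
    (hZ : ∀ g : A ⟶ A, (∀ χ : A ⟶ A, g ≫ χ = χ ≫ g) →
      ∃ N : ℤ, N ≠ 0 ∧ End.of (N • g) ∈ Subring.closure {End.of ψ})
    (hB : ∀ χ : A ⟶ A, pullbackOne A χ ∈
      Algebra.adjoin ℂ (symmetricPullbackSpan A h : Set (Module.End ℂ (complexBetti A.X 1)))) :
    (∀ z ∈ Subgroup.center (divisorLefschetzGroup A h), z * z = 1) ∧
      Finite (Subgroup.center (divisorLefschetzGroup A h)) ∧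
      Nat.card (Subgroup.center (divisorLefschetzGroup A h)) ≤ 2 ^ R.natDegree := by
  have hGS := divisorLefschetzGroup_eq_unitaryCentralizerGroup_of_forall_mem_adjoin hB
  -- a central `z` lies in `Z(E'') = ℂ[ψ^*]`
  have hmem : ∀ z : divisorLefschetzGroup A h, z ∈ Subgroup.center (divisorLefschetzGroup A h) →
      ((z : complexBetti A.X 1 ≃ₗ[ℂ] complexBetti A.X 1) : Module.End ℂ (complexBetti A.X 1)) ∈
        Algebra.adjoin ℂ ({pullbackOne A ψ} : Set (Module.End ℂ (complexBetti A.X 1))) := by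
    intro z hz
    have hzE : ((z : complexBetti A.X 1 ≃ₗ[ℂ] complexBetti A.X 1) : Module.End ℂ (complexBetti A.X 1)) ∈
        bicommutant A := mem_bicommutant_iff_mem_span.2 ((mem_center_divisorLefschetzGroup_iff_coe_mem_span hh hB).1 hz)
    have hzS : (z : complexBetti A.X 1 ≃ₗ[ℂ] complexBetti A.X 1) ∈ unitaryCentralizerGroup A h := by
      rw [← hGS]; exact z.2
    have hzC : ((z : complexBetti A.X 1 ≃ₗ[ℂ] complexBetti A.X 1) : Module.End ℂ (complexBetti A.X 1)) ∈
        centralizerAlgebra A := by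
      refine mem_centralizerAlgebra_iff.2 fun φ ↦ LinearMap.ext fun x ↦ ?_
      rw [Module.End.mul_apply, Module.End.mul_apply, LinearEquiv.coe_coe, (mem_centralizerGroup_iff.1 hzS.1) φ x]
    exact mem_adjoin_pullbackOne_of_center_le (center_le_adjoin_of_forall_central hZ) hzE
      fun X hX ↦ ((Subalgebra.mem_centralizer_iff ℂ).1 hX _ hzC).symm
  -- … and is an involution (`ψ` symmetric: the tree's sign-element lemma)
  have hinv : ∀ z : divisorLefschetzGroup A h, z ∈ Subgroup.center (divisorLefschetzGroup A h) → z * z = 1 := by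
    intro z hz
    have hz' := hmem z hz
    rw [Algebra.adjoin_singleton_eq_range_aeval] at hz'
    obtain ⟨p, hp⟩ := (AlgHom.mem_range _).1 hz'
    exact Subtype.ext (mul_self_eq_one_of_mem_divisorLefschetzGroup_coe_eq_aeval hRirr hψR hsym hnd z.2 hp.symm)
  exact ⟨hinv, finite_center_divisorLefschetzGroup_of_forall hRirr hψR hmem hinv⟩

end EndLevel

end Literature.AlgebraicGeometry.HodgeTheory

end
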